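import Summits.QuantumFields.BalabanUV.T4Continuum.Support.NE3QuadRemainderSup
import Summits.QuantumFields.BalabanUV.T4Continuum.Support.NE3LinearisedAverageL2
import HarnessLib

/-!
# NE7QuadRemL2Reduction — THE k-FOLD QUADRATIC REMAINDER IN `ℓ²` (MINKOWSKI FORM), REDUCED TO THE LEVEL-WISE ONE-STEP REMAINDERS WITH A k-FREE CONSTANT
# (memo ROAD-G102 §9 STEP 2, §10.1(d))

Cell `pub-balaban`, lineage `t4-ne7-p1` (CRUX PROVER NE7 #1, owner of BINDER row NE7), gen 102; the `ℓ²` twin of `NE7QuadRemL1Reduction` (same induction over the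
telescope `NE3QuadRemainderTower.dirIter_push_telescope`, same level packages), with row Π-D's TWO-TERM `ℓ²` letter of the linearised k-fold average
`NE3LinearisedAverageL2.l2sq_dirIter_le_two_term` (`3 ≤ d`, class only: `l2sq(dirIter_m Y) ≤ (8(L²∕L^d)^m + 384d²L)·l2sq Y`) and Minkowski (`NE3CovariantLineSumsL2.sqrt_l2sq_add_le`):
  `√l2sq_N([relIter − dirIter]_K X) ≤ √C₂(d,L) · Σ_{i<K} √l2sq_{L^{K−1−i}N}(E_i)`,  `C₂(d,L) = 8 + 384·d²·L`,
`E_i` the one-step remainder at level `i` — the currency of the direct letter (DL2) of hDL′ (`√dirSq φ ≤ q₂·E_w`; `dirSq ψ F = l2sq F ψ`).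
-/

set_option autoImplicit false

open scoped BigOperators Matrix.Norms.L2Operator
open NormedSpace Finset

namespace Summit.QuantumFields.BalabanUV.T4Continuum.NE7QuadRemL2Reduction

open Literature.MathematicalPhysics.QuantumFieldTheory.Balaban1983to89
open B7Prop1Explicit B7Prop2Explicit
open T4AveragingDeficitWall (IsSkewDir IsUnitaryCfg SmallField)
open T4AveragingDeficitWallBoundary (IsPeriodicCfg periodBox)
open AveragingDeficitPeriodicCounting (IsPeriodicDir)
open AveragingDeficitChartCalculus (cavg)
open AveragingDeficitMultiLevelPrep (cpush cavgIter radIter tower LevelSmall)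
open BlockAverageVaryDisc (rho0)
open NE3TangentCovariantTower (dirIter dirIter_zero)
open NE3LinearisedAverageSup (curvSum)
open NE3QuadRemainderTower (relStep relIter relIter_zero dirIter_push_telescope relIter_skew)
open NE3QuadRemainderLevels (levelPkg level_remainder)
open NE3QuadRemainderSup (norm_relIter_le sigma_lines)
open NE3FramePotBoundW (tower_eq_pow_mul)
open NE3CovariantLineSumsL2 (l2sq l2sq_nonneg sqrt_l2sq_add_le)
open NE3LinearisedAverageL2 (l2sq_dirIter_le_two_term)

noncomputable section

variable {d : ℕ} {n : Type*} [Fintype n] [DecidableEq n] [Nonempty n]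

omit [Fintype n] [DecidableEq n] [Nonempty n] in
/-- The `m`-level two-term constant is below `C₂(d,L) := 8 + 384d²L` (`L ≥ 2`, `d ≥ 3`). [folklore] -/
theorem twoTerm_le_C2 {L m : ℕ} (hd : 3 ≤ d) (hL : 2 ≤ L) :
    8 * ((L : ℝ) ^ 2 / (L : ℝ) ^ d) ^ m + 8 * (d : ℝ) * (48 * ((d : ℝ) * L)) ≤ 8 + 384 * (d : ℝ) ^ 2 * L := by
  have hL1 : (1 : ℝ) ≤ L := by exact_mod_cast (show 1 ≤ L by omega)
  have hq1 : (L : ℝ) ^ 2 / (L : ℝ) ^ d ≤ 1 := by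
    rw [div_le_one (by positivity)]
    exact pow_le_pow_right₀ hL1 (by omega)
  have hq0 : 0 ≤ (L : ℝ) ^ 2 / (L : ℝ) ^ d := by positivity
  have hpow : ((L : ℝ) ^ 2 / (L : ℝ) ^ d) ^ m ≤ 1 := pow_le_one₀ hq0 hq1
  nlinarith

omit [Nonempty n] in
/-- `√l2sq (c • f)`-type scaling: if `l2sq F g ≤ c·l2sq G f` with `0 ≤ c` then `√l2sq F g ≤ √c·√l2sq G f`. [folklore] -/
theorem sqrt_le_of_sq_le {F G : Finset (Site d)} {f g : Site d → Fin d → Matrix n n ℂ} {c : ℝ} (hc : 0 ≤ c) (h : l2sq F g ≤ c * l2sq G f) :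
    Real.sqrt (l2sq F g) ≤ Real.sqrt c * Real.sqrt (l2sq G f) := by
  rw [← Real.sqrt_mul hc]
  exact Real.sqrt_le_sqrt h

/-- **THE k-FOLD QUADRATIC REMAINDER IN `ℓ²` IS BELOW THE SUM OF THE LEVEL-WISE ONE-STEP REMAINDERS IN `ℓ²`, k-FREE (Minkowski form).**  For `3 ≤ d`, `2 ≤ L`,
`1 ≤ N`, a unitary `(L^K·N)`-periodic `W` in the tower class (`0 ≤ x`, `LevelSmall d L K x`, `SmallField W x`, `curvSum d L K x ≤ 2L∕3`), a skew `(L^K·N)`-periodic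
`X` of sup `s` on the σ-line `4(3+12d)²L^K s ≤ ρ₀²`:
`√l2sq_{periodBox N}([relIter − dirIter] L K W X) ≤ √(8 + 384d²L) · Σ_{i<K} √l2sq_{periodBox (L^{K−1−i}·N)}(E_i)`,
`E_i = relStep (cavgIter L i W) (relIter L i W X) − cpush (cavgIter L i W) (relIter L i W X)`. [folklore] -/
theorem sqrt_l2sq_relIter_sub_dirIter_le {L N K : ℕ} [NeZero N] (hd : 3 ≤ d) (hL : 2 ≤ L) (hN : 1 ≤ N) {W : Site d → Fin d → (Matrix n n ℂ)ˣ} {x : ℝ}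
    (hWu : IsUnitaryCfg W) (hWP : IsPeriodicCfg W ((L ^ K * N : ℕ) : ℤ)) (hx : 0 ≤ x) (hsm : LevelSmall d L K x) (hWx : SmallField W x)
    (hA : curvSum d L K x ≤ 2 / 3 * L)
    {X : Site d → Fin d → Matrix n n ℂ} (hXs : IsSkewDir X) (hXP : IsPeriodicDir X ((L ^ K * N : ℕ) : ℤ))
    {s : ℝ} (hs : 0 ≤ s) (hX : ∀ (z : Site d) (μ : Fin d), ‖X z μ‖ ≤ s)
    (hσ : 4 * (3 + 12 * (d : ℝ)) ^ 2 * (L : ℝ) ^ K * s ≤ rho0 d L ^ 2) :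
    Real.sqrt (l2sq (periodBox (d := d) N) (fun z κ => relIter L K W X z κ - dirIter L K W X z κ))
      ≤ Real.sqrt (8 + 384 * (d : ℝ) ^ 2 * L) * ∑ i ∈ range K,
          Real.sqrt (l2sq (periodBox (d := d) (L ^ (K - 1 - i) * N))
            (fun z κ => relStep L (cavgIter L i W) (relIter L i W X) z κ - cpush L (cavgIter L i W) (relIter L i W X) z κ)) := by
  have hL1 : 1 ≤ L := by omega
  have hC0 : 0 ≤ 8 + 384 * (d : ℝ) ^ 2 * L := by positivity
  have hC1 : 1 ≤ Real.sqrt (8 + 384 * (d : ℝ) ^ 2 * L) := by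
    rw [show (1 : ℝ) = Real.sqrt 1 from Real.sqrt_one.symm]
    exact Real.sqrt_le_sqrt (by nlinarith [show (0 : ℝ) ≤ 384 * (d : ℝ) ^ 2 * L by positivity])
  -- (1) sup, regime, skewness at every level
  have hsup : ∀ i ≤ K, ∀ (z : Site d) (μ : Fin d), ‖relIter L i W X z μ‖ ≤ 2 * (3 + 12 * (d : ℝ)) * (L : ℝ) ^ i * s :=
    fun i hi z μ => norm_relIter_le hL hWu hWP hx hsm hWx hA hXs hXP hs hX hσ hi z μ
  have hreg : ∀ i < K, ∃ a t : ℝ, 0 ≤ a ∧ 512 * (d + 1) * (d + 4) * (L : ℝ) ^ 2 * a ≤ 1 ∧ IsUnitaryCfg (cavgIter L i W)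
      ∧ SmallField (cavgIter L i W) a ∧ 0 ≤ t ∧ (∀ (y : Site d) (κ : Fin d), ‖relIter L i W X y κ‖ ≤ t) ∧ t ≤ rho0 d L / 4 := by
    intro i hi
    obtain ⟨hU, hr, hS, -, h512, -, -⟩ := levelPkg hL1 hWu hWP hx hsm hWx hA (i := i) (by omega)
    exact ⟨_, _, hr, h512, hU, hS, by positivity, hsup i hi.le, (sigma_lines (d := d) hL hs hσ (i := i) hi.le).1⟩
  have hskew : ∀ i ≤ K, IsSkewDir (relIter L i W X) := fun i hi =>
    relIter_skew hL1 i hXs fun i' hi' => hreg i' (by omega)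
  have hE : ∀ i < K,
      IsSkewDir (fun z κ => relStep L (cavgIter L i W) (relIter L i W X) z κ - cpush L (cavgIter L i W) (relIter L i W X) z κ)
      ∧ IsPeriodicDir (fun z κ => relStep L (cavgIter L i W) (relIter L i W X) z κ - cpush L (cavgIter L i W) (relIter L i W X) z κ)
          ((L ^ (K - i - 1) * N : ℕ) : ℤ) := by
    intro i hi
    obtain ⟨-, h2, h3, -⟩ := level_remainder hL1 hWu hWP hx hsm hWx hA hi hXP (hskew i hi.le) (t := 2 * (3 + 12 * (d : ℝ)) * (L : ℝ) ^ i * s)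
      (by positivity) (hsup i hi.le) (sigma_lines (d := d) hL hs hσ (i := i) hi.le).1
    exact ⟨h2, h3⟩
  -- (2) the target
  rcases K with _ | k'
  · simp only [Finset.range_zero, Finset.sum_empty, mul_zero]
    refine le_of_eq ?_
    rw [Real.sqrt_eq_zero']
    refine le_of_eq ?_
    unfold l2sq
    refine Finset.sum_eq_zero fun z _ => Finset.sum_eq_zero fun κ _ => ?_
    rw [relIter_zero, dirIter_zero]
    simp
  · -- the ℓ² letter of an `m`-fold push from level `i+1` (`i + 1 + m = k' + 1`)
    have hpush : ∀ (i m : ℕ), i + 1 + m = k' + 1 →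
        ∀ {E : Site d → Fin d → Matrix n n ℂ}, IsSkewDir E → IsPeriodicDir E ((L ^ (k' + 1 - i - 1) * N : ℕ) : ℤ) →
          Real.sqrt (l2sq (periodBox (d := d) N) (dirIter L m (cavgIter L (i + 1) W) E))
            ≤ Real.sqrt (8 + 384 * (d : ℝ) ^ 2 * L) * Real.sqrt (l2sq (periodBox (d := d) (L ^ (k' + 1 - 1 - i) * N)) E) := by
      intro i m him E hEs hEP
      have hKi : k' + 1 - i - 1 = m := by omega
      have hKi' : k' + 1 - 1 - i = m := by omega
      rw [hKi] at hEP
      rw [hKi']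
      rcases m with _ | m'
      · rw [dirIter_zero, pow_zero, one_mul]
        have h0 := Real.sqrt_nonneg (l2sq (periodBox (d := d) N) E)
        nlinarith
      · obtain ⟨hU, hr, hS, hP, -, hls, -⟩ := levelPkg hL1 hWu hWP hx hsm hWx hA (i := i + 1) (by omega)
        have hP' : IsPeriodicCfg (cavgIter L (i + 1) W) ((tower L N (m' + 1) : ℕ) : ℤ) := by
          rw [tower_eq_pow_mul, show k' + 1 - (i + 1) = m' + 1 by omega] at *; exact hP
        have hEP' : IsPeriodicDir E ((tower L N (m' + 1) : ℕ) : ℤ) := by rw [tower_eq_pow_mul]; exact hEP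
        have hlsm : LevelSmall d L m' (radIter d L (i + 1) x) := by
          have := hls (m' + 1) (by omega) (by omega); simpa using this
        have h := l2sq_dirIter_le_two_term hd hL hN m' hU hP' hr hlsm hS hEs hEP'
        rw [tower_eq_pow_mul, ← add_mul] at h
        have h2 := sqrt_le_of_sq_le (by positivity) h
        refine h2.trans (mul_le_mul_of_nonneg_right (Real.sqrt_le_sqrt (twoTerm_le_C2 (m := m' + 1) hd hL)) (Real.sqrt_nonneg _))
    have hQ : ∀ j : ℕ, j ≤ k' →
        Real.sqrt (l2sq (periodBox (d := d) N) (fun z κ => dirIter L (k' - j) (cavgIter L (j + 1) W)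
            (fun y μ => relIter L (j + 1) W X y μ - dirIter L (j + 1) W X y μ) z κ))
          ≤ Real.sqrt (8 + 384 * (d : ℝ) ^ 2 * L) * ∑ i ∈ range (j + 1),
              Real.sqrt (l2sq (periodBox (d := d) (L ^ (k' + 1 - 1 - i) * N))
                (fun z κ => relStep L (cavgIter L i W) (relIter L i W X) z κ - cpush L (cavgIter L i W) (relIter L i W X) z κ)) := by
      intro j
      induction j with
      | zero =>
          intro _
          obtain ⟨h2, h3⟩ := hE 0 (by omega)
          have h := hpush 0 k' (by omega) h2 h3
          rw [Nat.sub_zero, Finset.sum_range_one]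
          exact (le_of_eq (by rfl)).trans h
      | succ j ihj =>
          intro hj
          obtain ⟨hU1, hr1, hS1, -, h5121, -, -⟩ := levelPkg hL1 hWu hWP hx hsm hWx hA (i := j + 1) (by omega)
          obtain ⟨hU2, hr2, hS2, -, -, hls2, -⟩ := levelPkg hL1 hWu hWP hx hsm hWx hA (i := j + 1 + 1) (by omega)
          have hsm2 : k' - (j + 1) = 0 ∨ LevelSmall d L (k' - (j + 1) - 1) (radIter d L (j + 1 + 1) x) := by
            rcases Nat.eq_zero_or_pos (k' - (j + 1)) with h0 | hpos
            · exact Or.inl h0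
            · exact Or.inr (hls2 (k' - (j + 1)) (by omega) hpos)
          have htel : (fun z κ => dirIter L (k' - (j + 1)) (cavgIter L (j + 1 + 1) W)
                (fun y μ => relIter L (j + 1 + 1) W X y μ - dirIter L (j + 1 + 1) W X y μ) z κ)
              = fun z κ => dirIter L (k' - (j + 1)) (cavgIter L (j + 1 + 1) W)
                    (fun y μ => relStep L (cavgIter L (j + 1) W) (relIter L (j + 1) W X) y μ
                      - cpush L (cavgIter L (j + 1) W) (relIter L (j + 1) W X) y μ) z κ
                  + dirIter L (k' - j) (cavgIter L (j + 1) W) (fun y μ => relIter L (j + 1) W X y μ - dirIter L (j + 1) W X y μ) z κ := by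
            funext z κ
            rw [dirIter_push_telescope hL1 (j + 1) (k' - (j + 1)) hU1 hr1 h5121 hS1 hU2 hr2 hsm2 hS2 X z κ,
              show k' - (j + 1) + 1 = k' - j by omega]
          rw [htel]
          refine (sqrt_l2sq_add_le _ _ _).trans ?_
          obtain ⟨h2, h3⟩ := hE (j + 1) (by omega)
          have hfirst := hpush (j + 1) (k' - (j + 1)) (by omega) h2 h3
          have hsecond := ihj (by omega)
          have hsr := Finset.sum_range_succ (fun i => Real.sqrt (l2sq (periodBox (d := d) (L ^ (k' + 1 - 1 - i) * N))
              (fun z κ => relStep L (cavgIter L i W) (relIter L i W X) z κ - cpush L (cavgIter L i W) (relIter L i W X) z κ))) (j + 1)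
          rw [hsr, mul_add, add_comm (Real.sqrt (8 + 384 * (d : ℝ) ^ 2 * L) * _)]
          exact add_le_add hfirst hsecond
    have h := hQ k' le_rfl
    rw [Nat.sub_self] at h
    simpa only [dirIter_zero] using h

end

end Summit.QuantumFields.BalabanUV.T4Continuum.NE7QuadRemL2Reduction
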